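import Literature.Computability.Cryptography.UnitResidueMain
import HarnessLib

/-!
# Register bounds for the unit-residue machine

Topic `Computability/Cryptography`, support for `UnitResidueSim.lean`: elementary size bounds on the
quantities of the abstract algorithm of `UnitResidueSteps/Giant/Walk/Levels/Algorithm/Main.lean`
(exponents of floats, the extended-Euclid state, frames), in the form needed to show that the clamps
of the register program of `UnitResidueMachine.lean` never fire. Everything is proved; no facts.

## References

* M. J. Jacobson Jr., H. C. Williams, *Solving the Pell Equation*, Springer 2009, Ch. 12. [JacobsonWilliams2008]
* D. E. Knuth, *The Art of Computer Programming*, Vol. 2, §4.2.1, §4.5.2. [KnuthTAOCP2]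
-/

noncomputable section

open scoped Classical

namespace Literature.Computability.Cryptography.UnitResidue

open Literature.NumberTheory.QuadraticFields.Infra

/-! ### Sizes -/

/-- `isize` is monotone. [folklore] -/
theorem isize_mono {a b : ℤ} (hab : a ≤ b) : isize a ≤ isize b := by
  unfold isize
  exact Nat.size_le_size (by omega)

/-- Nonpositive integers have size `0`. [folklore] -/
theorem isize_nonpos {a : ℤ} (ha : a ≤ 0) : isize a = 0 := by
  unfold isize; rw [Int.toNat_eq_zero.mpr ha]; rfl

/-- `size (u 2^T) ≤ size u + T`. [folklore] -/
theorem isize_mul_two_pow_le (u : ℤ) (T : ℕ) : isize (u * 2 ^ T) ≤ isize u + T := by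
  rcases le_or_gt u 0 with hu | hu
  · rw [isize_nonpos (mul_nonpos_of_nonpos_of_nonneg hu (by positivity))]; omega
  · rw [isize_le_iff (by positivity), pow_add]
    exact mul_lt_mul_of_pos_right (lt_two_pow_isize hu.le) (by positivity)

/-- `size (a / v) ≤ size a` for `v ≥ 1`, `a ≥ 0`. [folklore] -/
theorem isize_ediv_le {a : ℤ} (v : ℤ) (ha : 0 ≤ a) : isize (a / v) ≤ isize a :=
  isize_mono (Int.ediv_le_self v ha)

/-- The machine quantity `isize_natAbs` agrees with the abstract parameter of the run. [folklore] -/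
theorem isize_natAbs_eq (z : ℤ) (hz : 0 ≤ z) : Nat.size z.natAbs = isize z := by
  unfold isize; congr 1; omega

/-! ### Exponents of floats -/

/-- The shift `t` of `floatOf` is at most `P + 3 + size v`. [folklore] -/
theorem floatT_le (P : ℕ) (u v : ℤ) : floatT P u v ≤ P + 3 + isize v := Nat.sub_le _ _

/-- `size ⌊u 2^t / v⌋ ≤ size u + t`. [folklore] -/
theorem isize_floatM1_le {P : ℕ} {u : ℤ} (v : ℤ) (hu : 0 ≤ u) :
    isize (floatM1 P u v) ≤ isize u + floatT P u v := by
  unfold floatM1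
  exact (isize_ediv_le v (by positivity)).trans (isize_mul_two_pow_le u _)

/-- The final shift of `floatOf` is at most `size u + P + 3 + size v`. [folklore] -/
theorem floatSh_le {P : ℕ} {u : ℤ} (v : ℤ) (hu : 0 ≤ u) :
    floatSh P u v ≤ isize u + (P + 3 + isize v) := by
  unfold floatSh
  have := isize_floatM1_le (P := P) v hu
  have := floatT_le P u v
  omega

/-- `|E| ≤ size u + 2 (P + 3 + size v)` for the float of `u/v`. [folklore] -/
theorem abs_floatOf_snd_le {P : ℕ} {u : ℤ} (v : ℤ) (hu : 0 ≤ u) :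
    |(floatOf P u v).2| ≤ isize u + 2 * (P + 3 + isize v) := by
  have h1 := floatSh_le (P := P) v hu
  have h2 := floatT_le P u v
  show |((floatSh P u v : ℕ) : ℤ) - (floatT P u v : ℕ)| ≤ _
  rw [abs_le]; constructor <;> omega

/-- The mantissa of the float of `u/v` is at most `u 2^{P + 3 + size v}`. [folklore] -/
theorem abs_floatOf_fst_le {P : ℕ} {u v : ℤ} (hu : 0 ≤ u) (hv : 1 ≤ v) :
    |(floatOf P u v).1| ≤ u * 2 ^ (P + 3 + isize v) := by
  have hM1 : 0 ≤ floatM1 P u v := by unfold floatM1; exact Int.ediv_nonneg (by positivity) (by omega)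
  show |floatM1 P u v / 2 ^ floatSh P u v| ≤ _
  rw [abs_of_nonneg (Int.ediv_nonneg hM1 (by positivity))]
  refine (Int.ediv_le_self _ hM1).trans ?_
  unfold floatM1
  refine (Int.ediv_le_self _ (by positivity)).trans ?_
  exact mul_le_mul_of_nonneg_left (pow_le_pow_right₀ (by norm_num) (floatT_le P u v)) hu

/-- `|E| ≤ |E₁| + |E₂| + P + 1` for a product of floats. [folklore] -/
theorem abs_mulF_snd_le (P : ℕ) (M₁ E₁ M₂ E₂ : ℤ) : |(mulF P M₁ E₁ M₂ E₂).2| ≤ |E₁| + |E₂| + P + 1 := by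
  have a1 := le_abs_self E₁; have a2 := neg_abs_le E₁; have b1 := le_abs_self E₂; have b2 := neg_abs_le E₂
  have hP : (0 : ℤ) ≤ P := by positivity
  unfold mulF; split_ifs <;> simp only <;> rw [abs_le] <;> constructor <;> linarith

/-- `|M| ≤ |M₁ M₂|` for a product of floats. [folklore] -/
theorem abs_mulF_fst_le (P : ℕ) (M₁ E₁ M₂ E₂ : ℤ) : |(mulF P M₁ E₁ M₂ E₂).1| ≤ |M₁ * M₂| := by
  unfold mulF; split_ifs <;> exact Int.abs_ediv_le_abs _ _

/-! ### Exponent growth per step -/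

variable {pm : Prm}

/-- `0 ≤ Sq ≤ 2^q Δ`. [folklore] -/
theorem Prm.OK.sq_le (h : pm.OK) : 0 ≤ pm.Sq ∧ pm.Sq ≤ 2 ^ pm.q * (pm.Δ : ℤ) := by
  refine ⟨by rw [h.sq_def]; positivity, ?_⟩
  have h1 := h.sq_bounds.1
  have hΔ1 : (1 : ℝ) ≤ pm.Δ := by exact_mod_cast h.disc.one_le
  have hrt : rt pm.Δ ≤ pm.Δ := by
    have := rt_sq pm.Δ; have := rt_pos h.disc; nlinarith
  have : (pm.Sq : ℝ) ≤ (2 : ℝ) ^ pm.q * pm.Δ := h1.trans (by gcongr)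
  exact_mod_cast this

/-- `size |b 2^q + Sq| ≤ |Δ| + q + 2` when `|b| ≤ 2Δ`. [folklore] -/
theorem Prm.OK.isize_facU_le (h : pm.OK) {b : ℤ} (hb : |b| ≤ 2 * pm.Δ) :
    isize (facU pm b) ≤ Nat.size pm.Δ + pm.q + 2 := by
  obtain ⟨hS0, hS⟩ := h.sq_le
  have hΔ : (pm.Δ : ℤ) < 2 ^ Nat.size pm.Δ := by exact_mod_cast Nat.lt_size_self pm.Δ
  unfold facU
  rw [isize_le_iff (abs_nonneg _)]
  have e1 : |b * 2 ^ pm.q| = |b| * 2 ^ pm.q := by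
    rw [abs_mul, abs_of_pos (pow_pos (show (0 : ℤ) < 2 by norm_num) pm.q)]
  have e2 : |pm.Sq| = pm.Sq := abs_of_nonneg hS0
  calc |b * 2 ^ pm.q + pm.Sq| ≤ |b| * 2 ^ pm.q + pm.Sq := by
        refine (abs_add_le _ _).trans ?_; rw [e1, e2]
    _ ≤ 2 * pm.Δ * 2 ^ pm.q + 2 ^ pm.q * pm.Δ := by gcongr
    _ = 3 * pm.Δ * 2 ^ pm.q := by ring
    _ < 2 ^ (Nat.size pm.Δ + 2) * 2 ^ pm.q := by
        apply mul_lt_mul_of_pos_right _ (by positivity); rw [pow_add]; nlinarith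
    _ = 2 ^ (Nat.size pm.Δ + pm.q + 2) := by rw [← pow_add]; ring_nf

/-- `size (a 2^{q+1}) ≤ |Δ| + q + 1` and `a 2^{q+1} ≥ 1` when `1 ≤ a ≤ Δ`. [folklore] -/
theorem isize_facV_le {a : ℕ} (ha : 1 ≤ a) (haΔ : a ≤ pm.Δ) :
    1 ≤ facV pm a ∧ isize (facV pm a) ≤ Nat.size pm.Δ + pm.q + 1 := by
  have hΔ : (pm.Δ : ℤ) < 2 ^ Nat.size pm.Δ := by exact_mod_cast Nat.lt_size_self pm.Δ
  have ha' : (1 : ℤ) ≤ a := by exact_mod_cast ha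
  have haΔ' : (a : ℤ) ≤ pm.Δ := by exact_mod_cast haΔ
  unfold facV
  have h2 := pow_pos (show (0 : ℤ) < 2 by norm_num) (pm.q + 1)
  refine ⟨by nlinarith, ?_⟩
  rw [isize_le_iff (by positivity)]
  calc (a : ℤ) * 2 ^ (pm.q + 1) ≤ pm.Δ * 2 ^ (pm.q + 1) := by gcongr
    _ < 2 ^ Nat.size pm.Δ * 2 ^ (pm.q + 1) := mul_lt_mul_of_pos_right hΔ h2
    _ = 2 ^ (Nat.size pm.Δ + pm.q + 1) := by rw [← pow_add, add_assoc]

/-- The per-step exponent increment `C₂ = 3|Δ| + 3q + 3P + 11`. [folklore] -/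
def Prm.C2 (pm : Prm) : ℕ := 3 * Nat.size pm.Δ + 3 * pm.q + 3 * pm.P + 11

/-- The squaring exponent increment `C₃ = 4P + 2|Δ| + 9`. [folklore] -/
def Prm.C3 (pm : Prm) : ℕ := 4 * pm.P + 2 * Nat.size pm.Δ + 9

/-- **One factor update adds at most `C₂` to `|E|`**: `|E'| ≤ |E| + C₂` for `bstepF`/`rstepF`, when
`1 ≤ a ≤ Δ`, `|b| ≤ 2Δ`. [folklore] -/
theorem Prm.OK.abs_mulFac_snd_le (h : pm.OK) {s : AS} (ha : 1 ≤ s.fr.a) (haΔ : s.fr.a ≤ pm.Δ)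
    (hb : |s.fr.b| ≤ 2 * pm.Δ) : |(s.mulFac pm).2| ≤ |s.E| + pm.C2 := by
  obtain ⟨hV1, hV⟩ := isize_facV_le (pm := pm) ha haΔ
  have hU := h.isize_facU_le hb
  have hf : |(facF pm s.fr.a s.fr.b).2| ≤ isize (facU pm s.fr.b) + 2 * (pm.P + 3 + isize (facV pm s.fr.a)) :=
    abs_floatOf_snd_le _ (abs_nonneg _)
  have hm := abs_mulF_snd_le pm.P s.M s.E (facF pm s.fr.a s.fr.b).1 (facF pm s.fr.a s.fr.b).2
  unfold AS.mulFac Prm.C2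
  have : (isize (facU pm s.fr.b) : ℤ) + 2 * (pm.P + 3 + isize (facV pm s.fr.a)) ≤
      3 * Nat.size pm.Δ + 3 * pm.q + 2 * pm.P + 10 := by omega
  push_cast
  linarith

/-- The mantissa of the factor float: `|M_fac| ≤ 2^{2|Δ| + 2q + P + 6}`. [folklore] -/
theorem Prm.OK.abs_facF_fst_le (h : pm.OK) {a : ℕ} {b : ℤ} (ha : 1 ≤ a) (haΔ : a ≤ pm.Δ)
    (hb : |b| ≤ 2 * pm.Δ) : |(facF pm a b).1| < 2 ^ (2 * Nat.size pm.Δ + 2 * pm.q + pm.P + 6) := by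
  obtain ⟨hV1, hV⟩ := isize_facV_le (pm := pm) ha haΔ
  have hU := h.isize_facU_le hb
  have hU0 : 0 ≤ facU pm b := abs_nonneg _
  have h1 : |(facF pm a b).1| ≤ facU pm b * 2 ^ (pm.P + 3 + isize (facV pm a)) := abs_floatOf_fst_le hU0 hV1
  have h2 : facU pm b < 2 ^ (Nat.size pm.Δ + pm.q + 2) := (isize_le_iff hU0).mp hU
  have h3 : (2 : ℤ) ^ (pm.P + 3 + isize (facV pm a)) ≤ 2 ^ (pm.P + 3 + (Nat.size pm.Δ + pm.q + 1)) :=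
    pow_le_pow_right₀ (by norm_num) (by omega)
  calc |(facF pm a b).1| ≤ facU pm b * 2 ^ (pm.P + 3 + isize (facV pm a)) := h1
    _ < 2 ^ (Nat.size pm.Δ + pm.q + 2) * 2 ^ (pm.P + 3 + (Nat.size pm.Δ + pm.q + 1)) :=
        mul_lt_mul h2 h3 (by positivity) (by positivity)
    _ = 2 ^ (2 * Nat.size pm.Δ + 2 * pm.q + pm.P + 6) := by rw [← pow_add]; ring_nf

/-- The exponent of the `(1/g)` float: `|E| ≤ 2P + 2|Δ| + 7` for `1 ≤ g ≤ Δ`. [folklore] -/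
theorem abs_floatOf_one_snd_le {g : ℤ} (hg : 1 ≤ g) (hgΔ : g ≤ pm.Δ) :
    |(floatOf pm.P 1 g).2| ≤ 2 * pm.P + 2 * Nat.size pm.Δ + 7 := by
  have h1 : |(floatOf pm.P 1 g).2| ≤ isize 1 + 2 * (pm.P + 3 + isize g) := abs_floatOf_snd_le g zero_le_one
  have h2 : isize g ≤ Nat.size pm.Δ := by
    rw [isize_le_iff (by omega)]
    have : (pm.Δ : ℤ) < 2 ^ Nat.size pm.Δ := by exact_mod_cast Nat.lt_size_self pm.Δ
    omega
  have h3 : isize 1 = 1 := rfl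
  rw [h3] at h1
  push_cast at h1 ⊢
  omega

/-- **Squaring at most doubles `|E|` plus `C₃`.** [folklore] -/
theorem abs_sqF_E_le {fuel : ℕ} {s : AS} (hg : 1 ≤ s.fr.g) (hgΔ : s.fr.g ≤ pm.Δ) :
    |(sqF pm fuel s).E| ≤ 2 * |s.E| + pm.C3 := by
  have h1 := abs_mulF_snd_le pm.P s.M s.E s.M s.E
  have h2 := abs_floatOf_one_snd_le (pm := pm) hg hgΔ
  have h3 := abs_mulF_snd_le pm.P (mulF pm.P s.M s.E s.M s.E).1 (mulF pm.P s.M s.E s.M s.E).2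
    (floatOf pm.P 1 s.fr.g).1 (floatOf pm.P 1 s.fr.g).2
  show |(mulF pm.P (mulF pm.P s.M s.E s.M s.E).1 (mulF pm.P s.M s.E s.M s.E).2
    (floatOf pm.P 1 s.fr.g).1 (floatOf pm.P 1 s.fr.g).2).2| ≤ _
  unfold Prm.C3; push_cast; linarith

/-! ### The extended-Euclid state stays small -/

/-- Bounds of the Euclid state: remainders in `[0, B]`, coefficients in `[0, x)`. [folklore] -/
def EuB (x B : ℤ) (st : ℤ × ℤ × ℤ × ℤ) : Prop :=
  0 ≤ st.1 ∧ st.1 ≤ B ∧ 0 ≤ st.2.1 ∧ st.2.1 ≤ B ∧ 0 ≤ st.2.2.1 ∧ st.2.2.1 < x ∧ 0 ≤ st.2.2.2 ∧ st.2.2.2 < x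

/-- The initial Euclid state is bounded. [folklore] -/
theorem euB_init {x y B : ℤ} (hx : 1 ≤ x) (hy : 0 ≤ y) (hxB : x ≤ B) (hyB : y ≤ B) : EuB x B (x, y, 0, 1 % x) :=
  ⟨by omega, hxB, hy, hyB, le_refl _, by simp; omega, Int.emod_nonneg _ (by omega), Int.emod_lt_of_pos _ (by omega)⟩

/-- A Euclid round keeps the bounds. [folklore] -/
theorem EuB.step {x B : ℤ} (hx : 1 ≤ x) {st : ℤ × ℤ × ℤ × ℤ} (h : EuB x B st) : EuB x B (invStep x st) := by
  obtain ⟨h1, h2, h3, h4, h5, h6, h7, h8⟩ := h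
  unfold invStep
  split_ifs with hz
  · exact ⟨h1, h2, h3, h4, h5, h6, h7, h8⟩
  · have hv : 0 < st.2.1 := lt_of_le_of_ne h3 (Ne.symm hz)
    exact ⟨h3, h4, Int.emod_nonneg _ hz, (Int.emod_lt_of_pos _ hv).le.trans h4, h7, h8,
      Int.emod_nonneg _ (by omega), Int.emod_lt_of_pos _ (by omega)⟩

/-- All Euclid iterates are bounded. [folklore] -/
theorem euB_iterate {x y B : ℤ} (hx : 1 ≤ x) (hy : 0 ≤ y) (hxB : x ≤ B) (hyB : y ≤ B) (k : ℕ) :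
    EuB x B ((invStep x)^[k] (x, y, 0, 1 % x)) := by
  induction k with
  | zero => exact euB_init hx hy hxB hyB
  | succ k ih => rw [Function.iterate_succ_apply']; exact ih.step hx

/-- **The Euclid loop computes the gcd** in its first component after `2 size y + 2` rounds.
[cite: KnuthTAOCP2, §4.5.2 Alg. X] -/
theorem euclid_fst_eq_gcd {x y : ℤ} (hx : 1 ≤ x) (hy : 0 ≤ y) {fuel : ℕ} (hfuel : 2 * isize y + 2 ≤ fuel) :
    ((invStep x)^[fuel] (x, y, 0, 1 % x)).1 = Int.gcd x y := by
  set k := isize y + 1 with hk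
  obtain ⟨h1, h2, h3⟩ := invStep_iterate_le (x := x) (by omega) hy k
  have hzero : ((invStep x)^[2 * k] (x, y, 0, 1 % x)).2.1 = 0 := by
    have hlt := lt_two_pow_isize hy
    by_contra hne
    have hpos : 1 ≤ ((invStep x)^[2 * k] (x, y, 0, 1 % x)).2.1 := by omega
    have : (2 : ℤ) ^ k ≤ y := by nlinarith [pow_pos (show (0:ℤ) < 2 by norm_num) k]
    rw [hk, pow_succ] at this
    nlinarith [pow_pos (show (0:ℤ) < 2 by norm_num) (isize y)]
  have hfix : (invStep x)^[fuel] (x, y, 0, 1 % x) = (invStep x)^[2 * k] (x, y, 0, 1 % x) := by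
    have : fuel = (fuel - 2 * k) + 2 * k := by omega
    rw [this, Function.iterate_add_apply, invStep_fixed hzero]
  obtain ⟨S₀, T₀, S₁, T₁, _, _, _, _, _, _, hgcd⟩ := invInv_iterate hx hy (2 * k)
  rw [hfix]
  rw [hzero, Int.gcd_zero_right] at hgcd
  rw [← hgcd]
  exact (Int.natAbs_of_nonneg h3).symm

/-! ### Shapes of guarded iterates -/

/-- A guarded walk is some number of plain steps. [folklore] -/
theorem gstep_iterate_exists (tgt : ℤ) (s : AS) (k : ℕ) : ∃ j, j ≤ k ∧ (gstep pm tgt)^[k] s = (bstepF pm)^[j] s := by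
  induction k with
  | zero => exact ⟨0, le_refl _, rfl⟩
  | succ k ih =>
    obtain ⟨j, hj, e⟩ := ih
    rw [Function.iterate_succ_apply', e]
    unfold gstep
    split_ifs
    · exact ⟨j + 1, by omega, (Function.iterate_succ_apply' _ _ _).symm⟩
    · exact ⟨j, by omega, rfl⟩

/-- A final walk is some number of plain frame steps. [folklore] -/
theorem finStep_iterate_exists (Δ : ℕ) (s : AS) (k : ℕ) :
    ∃ j, j ≤ k ∧ (finStep Δ)^[k] s = (fstepAS Δ)^[j] s := by
  induction k with
  | zero => exact ⟨0, le_refl _, rfl⟩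
  | succ k ih =>
    obtain ⟨j, hj, e⟩ := ih
    rw [Function.iterate_succ_apply', e]
    unfold finStep
    split_ifs
    · exact ⟨j, by omega, rfl⟩
    · exact ⟨j + 1, by omega, by rw [Function.iterate_succ_apply']; rfl⟩

/-- Plain frame steps keep `Inv ∧ Red` and the float. [folklore] -/
theorem fstepAS_iterate_spec {Δ : ℕ} (hΔ : IsDisc Δ) {s : AS} (hI : Inv Δ s.fr) (hR : Red Δ s.fr) (j : ℕ) :
    Inv Δ ((fstepAS Δ)^[j] s).fr ∧ Red Δ ((fstepAS Δ)^[j] s).fr ∧ ((fstepAS Δ)^[j] s).M = s.M ∧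
      ((fstepAS Δ)^[j] s).E = s.E ∧ ((fstepAS Δ)^[j] s).sgn = s.sgn := by
  induction j with
  | zero => exact ⟨hI, hR, rfl, rfl, rfl⟩
  | succ j ih =>
    obtain ⟨h1, h2, h3, h4, h5⟩ := ih
    rw [Function.iterate_succ_apply']
    exact ⟨h1.bstep h2, h2.bstep hΔ h1, h3, h4, h5⟩

/-! ### Frame bounds from the invariants -/

variable {Δ : ℕ}

/-- In a reduced frame `a ≤ Δ` and `|b| ≤ 2Δ` (indeed `0 < b < √Δ`). [cite: JacobsonWilliams2008, §5.1] -/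
theorem Red.frame_bounds {S : St} (hΔ : IsDisc Δ) (hR : Red Δ S) : S.a ≤ Δ ∧ |S.b| ≤ 2 * Δ := by
  have ha := hR.a_le_sqrt hΔ
  have hb := hR.b_pos
  have hb2 := hR.b_sq_lt
  have hs : (Nat.sqrt Δ : ℤ) ≤ Δ := by exact_mod_cast Nat.sqrt_le_self Δ
  have hΔ1 : (1 : ℤ) ≤ Δ := by exact_mod_cast hΔ.one_le
  refine ⟨by exact_mod_cast ha.trans hs, ?_⟩
  rw [abs_of_pos (by omega)]
  nlinarith

/-- In a normalised frame with `a ≤ Δ`, `|b| ≤ 2Δ`. [folklore] -/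
theorem Norm.abs_b_le {S : St} (hN : Norm Δ S) (ha : (S.a : ℤ) ≤ Δ) : |S.b| ≤ 2 * Δ := by
  have hs : (Nat.sqrt Δ : ℤ) ≤ Δ := by exact_mod_cast Nat.sqrt_le_self Δ
  have ha0 : (0 : ℤ) ≤ S.a := by positivity
  rw [abs_le]
  by_cases h : (Nat.sqrt Δ : ℤ) < S.a
  · have := hN.1 h; omega
  · push Not at h; have := hN.2 h; omega

/-- The norm of the squared frame is at most `Δ`, and its `b` at most `Δ + 2Δ²` in absolute value.
[folklore] -/
theorem Prm.OK.sq_frame_bounds (h : pm.OK) {s : AS} {ε : ℝ} (hg : Good pm s ε) (fuel : ℕ) :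
    1 ≤ (sqF pm fuel s).fr.a ∧ (sqF pm fuel s).fr.a ≤ pm.Δ ∧ |(sqF pm fuel s).fr.b| ≤ pm.Δ + 2 * pm.Δ ^ 2 ∧
      1 ≤ s.fr.g ∧ s.fr.g ≤ pm.Δ ∧ 1 ≤ s.fr.a1 ∧ s.fr.a1 ≤ pm.Δ ∧ 0 ≤ s.fr.b1 ∧ s.fr.b1 ≤ pm.Δ ∧
      1 ≤ s.fr.c pm.Δ ∧ s.fr.c pm.Δ ≤ pm.Δ := by
  have hI := hg.inv
  have hR := hg.red
  obtain ⟨ha1, hb1, _, hg1, hc0, _⟩ := h.bezout_hyps hI hR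
  obtain ⟨hb1Δ, hcΔ⟩ := bezout_sizes (pm := pm) hI hR
  obtain ⟨haΔ, _⟩ := Red.frame_bounds h.disc hR
  have haeq := hI.a_eq
  have ha : (1 : ℤ) ≤ s.fr.a := by exact_mod_cast hI.1
  have haΔ' : (s.fr.a : ℤ) ≤ pm.Δ := by exact_mod_cast haΔ
  have hgle : s.fr.g ≤ s.fr.a := by nlinarith
  have ha1le : s.fr.a1 ≤ s.fr.a := by nlinarith
  have hc1 := hI.c_pos hR
  have hA : ((sqF pm fuel s).fr.a : ℤ) = s.fr.a1 ^ 2 := hI.sq_a _ _ _ _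
  have hAlt : ((sqF pm fuel s).fr.a : ℤ) < pm.Δ := by
    have := hI.sq_a_lt hR (sqData pm s.fr fuel).1.1 (sqData pm s.fr fuel).1.2 (sqData pm s.fr fuel).2.1
      (sqData pm s.fr fuel).2.2
    exact_mod_cast this
  have hν : 0 ≤ (sqData pm s.fr fuel).1.2 ∧ (sqData pm s.fr fuel).1.2 < s.fr.a1 := by
    show 0 ≤ invMod s.fr.a1 s.fr.b1 fuel ∧ invMod s.fr.a1 s.fr.b1 fuel < s.fr.a1
    unfold invMod
    have := euB_iterate (B := max s.fr.a1 s.fr.b1) ha1 hb1 (le_max_left _ _) (le_max_right _ _) fuel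
    exact ⟨this.2.2.2.2.1, this.2.2.2.2.2.1⟩
  have hbR : 0 < s.fr.b ∧ s.fr.b ≤ pm.Δ := by
    have := hR.b_pos; have := hR.b_sq_lt; constructor <;> nlinarith
  refine ⟨?_, ?_, ?_, hg1, hgle.trans haΔ', ha1, ha1le.trans haΔ', hb1, hb1Δ, hc1, hcΔ⟩
  · have : (1 : ℤ) ≤ (sqF pm fuel s).fr.a := by rw [hA]; nlinarith
    exact_mod_cast this
  · exact_mod_cast hAlt.le
  · show |s.fr.b + 2 * (sqData pm s.fr fuel).1.2 * s.fr.a1 * s.fr.c pm.Δ| ≤ _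
    have h2 : |2 * (sqData pm s.fr fuel).1.2 * s.fr.a1 * s.fr.c pm.Δ| ≤ 2 * pm.Δ ^ 2 := by
      rw [abs_of_nonneg (mul_nonneg (mul_nonneg (mul_nonneg (by norm_num) hν.1) (by omega)) (by omega))]
      have : (sqData pm s.fr fuel).1.2 * s.fr.a1 ≤ s.fr.a1 ^ 2 := by nlinarith
      have : s.fr.a1 ^ 2 ≤ pm.Δ := by rw [← hA]; exact hAlt.le
      nlinarith
    refine (abs_add_le _ _).trans ?_
    rw [abs_of_pos hbR.1]
    linarith

end Literature.Computability.Cryptography.UnitResidue
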